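import Literature.NumberTheory.Automorphic.UnitaryGroupSymplecticCarriers
import HarnessLib

/-!
# Rank two: on `U(σ, H)` for a symmetric `2 × 2` form, entrywise conjugation is a determinant twist of an `H`-similitude conjugation

Topic `NumberTheory/Automorphic`; namespace `Literature.NumberTheory.Automorphic` (generic part, home of ★ `unitaryGroupOfForm`) and
`Literature.NumberTheory.Automorphic.UnitaryGroup` (the local unitary group ★ `«local» E c 2 J v`).  KERNEL ONLY: theorems; no definition,
no named fact, no `sorry`, no instance, no notation.  Cell `hodgecm-mathlib` (D-0151), programme P5 (crux HLiu418 = stmt-HodgeConjecture-24832),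
stone **L1** of the road card `F0/P5/A-p18/g23/ROAD-L4if-v2.A-p18g23.md` (A-p18 (g23), 2026-08-31): the group-theoretic identity behind step (M2)
«`π^{bar} ≅ (χ⁻¹ ∘ det) ⊗ π^{Ad h₀}`» of the in-house road for the last local letter L4if of #74.

THE MATHEMATICS (elementary; [MoeglinVignerasWaldspurger1987, Chap. 1 I.17] for the ambient objects).  Let `R` be a commutative ring,
`σ : R → R` a ring endomorphism, `H ∈ M₂(R)` SYMMETRIC with `σ(H) = H`, and `g ∈ U(σ, H)(R) = {g ∈ GL₂(R) : σ(g)ᵀ H g = H}` (★ `unitaryGroupOfForm`).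
Put `w = !![0, 1; -1, 0]` and `k := w H ∈ M₂(R)`.  For `2 × 2` matrices `adj(g)ᵀ = w g w⁻¹`, i.e. `w · adj(g)ᵀ = g · w` (`w_mul_adjugate_transpose`),
and `adj(g)ᵀ gᵀ = det g • 1`.  Transposing the defining relation (`gᵀ H σ(g) = H`, `H` symmetric) and multiplying by `w · adj(g)ᵀ` gives
* **`det g • (k · σ(g)) = g · k`** (`det_smul_w_mul_form_mul_map_eq`): entrywise `σ` on `U(σ, H)` is, up to the scalar `(det g)⁻¹`, conjugation by
  the `σ`-FIXED matrix `k⁻¹` — «`σ(g) = (det g)⁻¹ · k⁻¹ g k`»;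
* **`kᵀ H k = det H • H`** (`transpose_w_mul_form_mul_self`): `k` is an `H`-SIMILITUDE with multiplier `det H` (so `Ad k` is an automorphism of
  `U(σ, H)`, inner iff `det H` is a `σ`-norm times a square).
At a finite place `v` of `F` for a quadratic `E/F` (`R = E ⊗_F F_v`, `σ = c ⊗ 1`, `H = T ⊗ 1` the local form of a symmetric `T ∈ GL₂(F)`, ★
`localForm_eq_map`) this reads (§2): for `g ∈ U(T)(F_v)`, `det g • (k ḡ) = g k` with `k = w (T ⊗ 1)` `F_v`-rational, `kᵀ (T⊗1) k = det T • (T⊗1)`.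
CONSEQUENCE used by the road (stated in the card, not here): for every representation `π` of `U(T)(F_v)` with central character `χ` (`det` of a
central `z•1` is `z²`), `g ↦ π(ḡ)` is `(χ⁻¹ ∘ det) ⊗ (g ↦ π(k⁻¹ g k))`, and the multiplier `det T` of `k` together with the sign of the (bar) leg
(★-pending `LocalSymplecticEmbeddingGaloisConj`: `−δ` ↔ line `−a`) puts the partner theta lift on a line of the SAME class iff `−det T ∈ N(E_vˣ)`,
i.e. iff the binary hermitian space is isotropic at `v` — Liu's table in [Liu2021, Lem. D.1 (4)].
HONEST LABEL: nothing of the cited sources is asserted; HC_CM is proved only modulo the printed citations until rung 0 closes.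

## References
* [MoeglinVignerasWaldspurger1987] C. Mœglin, M.-F. Vignéras, J.-L. Waldspurger, LNM 1291 (1987), Chap. 1 I.17 (unitary groups of
  `ε`-hermitian forms and their similitudes).
* [Liu2021] Y. Liu, Camb. J. Math. 9 (2021), App. D Lemma D.1 (4), p. 126 (the isotropic∕anisotropic table this identity explains).
* [CasselsFrohlichANT1967] J. W. S. Cassels, A. Fröhlich (eds.), *Algebraic Number Theory* (1967), Ch. II §10 (`L ⊗_K K_v`).
-/

set_option autoImplicit false

open Matrix

namespace Literature.NumberTheory.Automorphic

/-! ## §1 `2 × 2` matrix algebra over a commutative ring -/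

section FinTwo

variable {R : Type*} [CommRing R]

/-- The matrix `w = !![0, 1; -1, 0]` realising `g ↦ adj(g)ᵀ` by conjugation on `2 × 2` matrices. [folklore] -/
private theorem w_mul_adjugate_transpose (g : Matrix (Fin 2) (Fin 2) R) :
    !![(0 : R), 1; -1, 0] * (adjugate g)ᵀ = g * !![(0 : R), 1; -1, 0] := by
  rw [adjugate_fin_two]
  ext i j
  fin_cases i <;> fin_cases j <;> simp [Matrix.mul_apply, Fin.sum_univ_two]

/-- `wᵀ A w = adj(A)ᵀ` for `2 × 2` matrices (`w = !![0, 1; -1, 0]`). [folklore] -/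
private theorem w_transpose_mul_mul_w (A : Matrix (Fin 2) (Fin 2) R) :
    (!![(0 : R), 1; -1, 0])ᵀ * A * !![(0 : R), 1; -1, 0] = (adjugate A)ᵀ := by
  rw [adjugate_fin_two]
  ext i j
  fin_cases i <;> fin_cases j <;> simp [Matrix.mul_apply, Fin.sum_univ_two]

/-- `adj(g)ᵀ gᵀ = det g • 1`. [folklore] -/
private theorem adjugate_transpose_mul_transpose (g : Matrix (Fin 2) (Fin 2) R) :
    (adjugate g)ᵀ * gᵀ = g.det • (1 : Matrix (Fin 2) (Fin 2) R) := by
  rw [← transpose_mul, mul_adjugate, transpose_smul, transpose_one]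

/-- **Entrywise `σ` on `U(σ, H)` in rank two is a determinant twist of a similitude conjugation.**  For a symmetric `σ`-fixed `2 × 2` form `H`
and `g ∈ U(σ, H)`: `det g • ((w H) · σ(g)) = g · (w H)`, `w = !![0,1;-1,0]` — i.e. `σ(g) = (det g)⁻¹ · (wH)⁻¹ g (wH)` whenever `det H` is a unit.
[cite: MoeglinVignerasWaldspurger1987, Chap. 1 I.17] -/
theorem det_smul_w_mul_form_mul_map_eq (σ : R →+* R) {H : Matrix (Fin 2) (Fin 2) R} (hH : Hᵀ = H) {g : GL (Fin 2) R}
    (hg : g ∈ unitaryGroupOfForm σ H) :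
    (g : Matrix (Fin 2) (Fin 2) R).det • (!![(0 : R), 1; -1, 0] * H * (g : Matrix (Fin 2) (Fin 2) R).map σ) =
      (g : Matrix (Fin 2) (Fin 2) R) * (!![(0 : R), 1; -1, 0] * H) := by
  rw [mem_unitaryGroupOfForm_iff] at hg
  -- transpose the defining relation: `gᵀ H σ(g) = H`
  have hT : (g : Matrix (Fin 2) (Fin 2) R)ᵀ * H * (g : Matrix (Fin 2) (Fin 2) R).map σ = H := by
    have := congrArg transpose hg
    rwa [transpose_mul, transpose_mul, transpose_transpose, hH, ← Matrix.mul_assoc] at this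
  -- `det g • (H σ(g)) = adj(g)ᵀ H`
  have hdet : (g : Matrix (Fin 2) (Fin 2) R).det • (H * (g : Matrix (Fin 2) (Fin 2) R).map σ) =
      (adjugate (g : Matrix (Fin 2) (Fin 2) R))ᵀ * H := by
    calc (g : Matrix (Fin 2) (Fin 2) R).det • (H * (g : Matrix (Fin 2) (Fin 2) R).map σ)
        = ((adjugate (g : Matrix (Fin 2) (Fin 2) R))ᵀ * (g : Matrix (Fin 2) (Fin 2) R)ᵀ) * (H * (g : Matrix (Fin 2) (Fin 2) R).map σ) := by
          rw [adjugate_transpose_mul_transpose, smul_mul_assoc, Matrix.one_mul]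
      _ = (adjugate (g : Matrix (Fin 2) (Fin 2) R))ᵀ * ((g : Matrix (Fin 2) (Fin 2) R)ᵀ * H * (g : Matrix (Fin 2) (Fin 2) R).map σ) := by
          simp only [Matrix.mul_assoc]
      _ = (adjugate (g : Matrix (Fin 2) (Fin 2) R))ᵀ * H := by rw [hT]
  calc (g : Matrix (Fin 2) (Fin 2) R).det • (!![(0 : R), 1; -1, 0] * H * (g : Matrix (Fin 2) (Fin 2) R).map σ)
      = !![(0 : R), 1; -1, 0] * ((g : Matrix (Fin 2) (Fin 2) R).det • (H * (g : Matrix (Fin 2) (Fin 2) R).map σ)) := by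
        rw [Matrix.mul_smul, Matrix.mul_assoc]
    _ = (!![(0 : R), 1; -1, 0] * (adjugate (g : Matrix (Fin 2) (Fin 2) R))ᵀ) * H := by rw [hdet, Matrix.mul_assoc]
    _ = (g : Matrix (Fin 2) (Fin 2) R) * (!![(0 : R), 1; -1, 0] * H) := by rw [w_mul_adjugate_transpose, Matrix.mul_assoc]

/-- **`k = wH` is an `H`-similitude with multiplier `det H`**: `(wH)ᵀ H (wH) = det H • H` for a symmetric `2 × 2` matrix `H`.
[cite: MoeglinVignerasWaldspurger1987, Chap. 1 I.17] -/
theorem transpose_w_mul_form_mul_self {H : Matrix (Fin 2) (Fin 2) R} (hH : Hᵀ = H) :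
    (!![(0 : R), 1; -1, 0] * H)ᵀ * H * (!![(0 : R), 1; -1, 0] * H) = H.det • H := by
  have hadj : (adjugate H)ᵀ = adjugate H := by rw [adjugate_transpose, hH]
  calc (!![(0 : R), 1; -1, 0] * H)ᵀ * H * (!![(0 : R), 1; -1, 0] * H)
      = Hᵀ * ((!![(0 : R), 1; -1, 0])ᵀ * H * !![(0 : R), 1; -1, 0]) * H := by
        rw [transpose_mul]; simp only [Matrix.mul_assoc]
    _ = H * adjugate H * H := by rw [w_transpose_mul_mul_w, hadj, hH]
    _ = H.det • H := by rw [mul_adjugate, smul_mul_assoc, Matrix.one_mul]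

/-- `k = wH` is fixed by `σ` when `H` is. [cite: MoeglinVignerasWaldspurger1987, Chap. 1 I.17] -/
theorem w_mul_form_map (σ : R →+* R) {H : Matrix (Fin 2) (Fin 2) R} (hHσ : H.map σ = H) :
    (!![(0 : R), 1; -1, 0] * H).map σ = !![(0 : R), 1; -1, 0] * H := by
  rw [Matrix.map_mul, hHσ]
  congr 1
  ext i j
  fin_cases i <;> fin_cases j <;> simp

/-- `det (wH) = det H` (`det w = 1`): the similitude `k = wH` is invertible exactly when `H` is. [cite: MoeglinVignerasWaldspurger1987, Chap. 1 I.17] -/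
theorem det_w_mul_form (H : Matrix (Fin 2) (Fin 2) R) : (!![(0 : R), 1; -1, 0] * H).det = H.det := by
  rw [det_mul, det_fin_two_of]
  ring

end FinTwo

/-! ## §2 The local unitary group `U(T)(F_v)` of a symmetric `T ∈ GL₂(F)` -/

namespace UnitaryGroup

open NumberField IsDedekindDomain

variable {F : Type} (E : Type) [Field F] [NumberField F] [Field E] [NumberField E] [Algebra F E]
variable (c : E ≃ₐ[F] E) {T : Matrix (Fin 2) (Fin 2) F} {J : Matrix (Fin 2) (Fin 2) E}

/-- The local form of `J = T ⊗ 1` at `v` is symmetric when `T` is (`L ⊗_K K_v` base change of an `F`-rational form). [cite: CasselsFrohlichANT1967, Ch. II §10] -/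
theorem localForm_transpose (v : HeightOneSpectrum (𝓞 F)) (hT : T.IsSymm) (hJ : J = T.map (algebraMap F E)) :
    ((adelicForm E 2 J).map (adeleToLocal E v))ᵀ = (adelicForm E 2 J).map (adeleToLocal E v) := by
  rw [localForm_eq_map E 2 v T hJ, ← Matrix.transpose_map, ← Matrix.transpose_map, hT.eq]

/-- The local form of `J = T ⊗ 1` at `v` is fixed by `c ⊗ 1` (its entries lie in `ι_v(F_v)`). [cite: CasselsFrohlichANT1967, Ch. II §10] -/
theorem localForm_map_conjLocal₂ (v : HeightOneSpectrum (𝓞 F)) (hJ : J = T.map (algebraMap F E)) :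
    ((adelicForm E 2 J).map (adeleToLocal E v)).map (conjLocal E c v) = (adelicForm E 2 J).map (adeleToLocal E v) := by
  rw [localForm_eq_map E 2 v T hJ, Matrix.map_map, Matrix.map_map]
  exact congrArg _ (funext fun t => conjLocal_toLocalRing c v _)

/-- **Rank two, at a finite place: `ḡ` is a determinant twist of the `k`-conjugate**, `k = w · (T ⊗ 1)` (`F_v`-rational): for `g ∈ U(T)(F_v)`
(★ `«local» E c 2 J v`, `J = T ⊗ 1`, `T` symmetric), `det g • (k ḡ) = g k`. [cite: MoeglinVignerasWaldspurger1987, Chap. 1 I.17] -/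
theorem det_smul_w_mul_localForm_mul_conj_eq (v : HeightOneSpectrum (𝓞 F)) (hT : T.IsSymm) (hJ : J = T.map (algebraMap F E))
    (g : «local» E c 2 J v) :
    g.1.1.det • (!![(0 : LocalRing E v), 1; -1, 0] * (adelicForm E 2 J).map (adeleToLocal E v) * g.1.1.map (conjLocal E c v)) =
      g.1.1 * (!![(0 : LocalRing E v), 1; -1, 0] * (adelicForm E 2 J).map (adeleToLocal E v)) :=
  det_smul_w_mul_form_mul_map_eq (conjLocal E c v) (localForm_transpose E v hT hJ) g.2

/-- … and `k = w · (T ⊗ 1)` is a `(T ⊗ 1)`-similitude with multiplier `det (T ⊗ 1)`, fixed by `c ⊗ 1`.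
[cite: MoeglinVignerasWaldspurger1987, Chap. 1 I.17] -/
theorem w_mul_localForm_similitude (v : HeightOneSpectrum (𝓞 F)) (hT : T.IsSymm) (hJ : J = T.map (algebraMap F E)) :
    (!![(0 : LocalRing E v), 1; -1, 0] * (adelicForm E 2 J).map (adeleToLocal E v))ᵀ * (adelicForm E 2 J).map (adeleToLocal E v) *
        (!![(0 : LocalRing E v), 1; -1, 0] * (adelicForm E 2 J).map (adeleToLocal E v)) =
      ((adelicForm E 2 J).map (adeleToLocal E v)).det • (adelicForm E 2 J).map (adeleToLocal E v) ∧
    (!![(0 : LocalRing E v), 1; -1, 0] * (adelicForm E 2 J).map (adeleToLocal E v)).map (conjLocal E c v) =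
      !![(0 : LocalRing E v), 1; -1, 0] * (adelicForm E 2 J).map (adeleToLocal E v) :=
  ⟨transpose_w_mul_form_mul_self (localForm_transpose E v hT hJ), w_mul_form_map (conjLocal E c v) (localForm_map_conjLocal₂ E c v hJ)⟩

end UnitaryGroup

end Literature.NumberTheory.Automorphic
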